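import Summits.SmoothPoincare4.SmoothPoincare4.Theorems.EntropyRungChangGurskyYangPinchingSetConvex
import Literature.Geometry.Riemannian.HamiltonCurvatureODEProofs
import Mathlib.Analysis.SpecialFunctions.Pow.Deriv
import Mathlib.Analysis.Calculus.MeanValue
import HarnessLib

/-!
# Margerin's pinching sets are preserved along the Ricci flow
(stub `stub_pinchingPreserved` of line `margerin-cone-hamilton-rails`, crux
`EntropyRung.ChangGurskyYang`, item stmt-SmoothPoincare4-10834)

STUB 3 of the line (the PDE transfer; Margerin 1998, Part I, Cor. 3 and Prop. 4; Hamilton 1986,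
§4–§5): GIVEN Margerin's polynomial inequality in margin form with margin `σ` on the cone
`margerinCone c` (STUB 1 of the line, a hypothesis here), every pinching set
`Z = pinchingSet m c K τ = margerinCone c ∩ {R ≥ m} ∩ {|𝒟|² ≤ K R^{2−τ}}` with `0 < m`, `0 < c`,
`0 < K`, `0 < τ < σ` is preserved along every Ricci flow of Riemannian metrics on `[0, T)` on a
closed smooth 4-manifold (blocks of every orthonormal frame; vocabulary of
`Theorems/EntropyRungMargerinRailsDefs.lean`).

Proof = the TENSOR ROUTE: Hamilton's maximum principle for the curvature ODE, a THEOREM of the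
tree (`hamilton_maximumPrinciple_curvatureODE_holds`; Hamilton 1986, Thm. 4.3; Chow–Lu 2004,
Thm. 3), applied to the constant family `fun _ ↦ Z` exactly as in
`ricciFlow_mem_pcoPinchingFive_of_maximumPrinciple`. Its hypotheses on `Z`: closed and convex
(`isClosed_pinchingSet`, `convex_pinchingSet`, file `…PinchingSetConvex`), symmetric under
`B ↦ −B` (`reflectB_mem_pinchingSet`, Defs file), and — the heart, proved here —
`isInvariant_pinchingSet`: forward invariance under Hamilton's ODE by a first-exit argument with
STRICT crossings (Mathlib's fencing lemma `image_le_of_deriv_right_lt_deriv_boundary` with the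
zero barrier, `nonpos_of_deriv_neg_at_zero`). Along a solution the Bianchi locus is preserved
(`isInvariant_isSymm`, `isInvariant_trace_eq`); `R' = scal (field ·) ≥ R²/2`
(`half_scal_sq_le_scal_field`) so `R ≥ m > 0` persists; `(|𝒟|²)' = 2⟨γ, γ'⟩ − R R'/3`
(`hasDerivAt_devNormSq`), so that BY DEFINITION `margerinP2 = R·(|𝒟|²)' − 2|𝒟|²·R'`; on
`{|𝒟|² = c R²}` the hypothesis gives `R·(|𝒟|² − cR²)' = P₂ ≤ −σ c R² R' < 0`, and then on
`{|𝒟|² = K R^{2−τ}}` (inside the cone by the previous step)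
`R·(|𝒟|² − K R^{2−τ})' = P₂ + τ|𝒟|²R' ≤ −(σ − τ)|𝒟|²R' < 0`.

Honours Disproof §3a: `[CompactSpace M]` is consumed by the maximum principle. Everything is
proved; no definition, no named fact.

References: C. Margerin, Comm. Anal. Geom. 6 (1998) 21–65, Part I, Cor. 3 and Prop. 4
(pp. 26–27), p. 56 [Margerin1998]; R. S. Hamilton, J. Differential Geom. 24 (1986) 153–179, §4,
Thm. 4.3 (p. 162), §5, Def. 5.1 and 5.2 (pp. 163–164) [Hamilton1986]; B. Chow, P. Lu, Pacific
J. Math. 214 (2004) 201–222, Thm. 3 [ChowLu2004].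
-/

noncomputable section

-- the registered namespace `Summit.SmoothPoincare4.SmoothPoincare4.Theorems` repeats a component
set_option linter.dupNamespace false

open Set Function Module
open scoped Manifold ContDiff Matrix BigOperators Topology

namespace Summit.SmoothPoincare4.SmoothPoincare4.Theorems.MargerinRails

open Literature.Geometry.Riemannian Literature.Geometry.Lorentzian
  Literature.Geometry.Lorentzian.PseudoRiemannianMetric
open Literature.Geometry.Riemannian.HamiltonODE hiding HasDerivAt

/-! ### Calculus along a curve of block triples -/

section ODE

variable {γ : ℝ → Blocks} {γ' : Blocks} {t : ℝ}

/-- Derivative of `Σᵢⱼ Xᵢⱼ(s)²` for an entrywise differentiable curve of matrices. [folklore] -/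
theorem hasDerivAt_frobSq {X : ℝ → Matrix (Fin 3) (Fin 3) ℝ} {X' : Matrix (Fin 3) (Fin 3) ℝ}
    (h : ∀ i j, HasDerivAt (fun s ↦ X s i j) (X' i j) t) :
    HasDerivAt (fun s ↦ frobSq (X s)) (2 * ∑ i, ∑ j, X t i j * X' i j) t := by
  have key : HasDerivAt (fun s ↦ ∑ i, ∑ j, X s i j ^ 2) (∑ i, ∑ j, 2 * (X t i j * X' i j)) t := by
    refine HasDerivAt.fun_sum fun i _ ↦ HasDerivAt.fun_sum fun j _ ↦ ?_
    have e : (fun s ↦ X s i j ^ 2) = fun s ↦ X s i j * X s i j := funext fun s ↦ sq _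
    rw [e]
    exact ((h i j).mul (h i j)).congr_deriv (by ring)
  refine (key.congr_deriv ?_)
  simp only [Finset.mul_sum]

/-- `R' = scal (γ')` along a differentiable curve. [folklore] -/
theorem hasDerivAt_scal (h : HamiltonODE.HasDerivAt γ γ' t) :
    HasDerivAt (fun s ↦ scal (γ s)) (scal γ') t :=
  h.trace_fst.add h.trace_snd_snd

/-- `(|Rm|²)' = 2⟨γ, γ'⟩` along a differentiable curve. [folklore] -/
theorem hasDerivAt_rmNormSq (h : HamiltonODE.HasDerivAt γ γ' t) :
    HasDerivAt (fun s ↦ rmNormSq (γ s)) (2 * pairing (γ t) γ') t := by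
  have hA := hasDerivAt_frobSq (X := fun s ↦ (γ s).1) h.1
  have hB := hasDerivAt_frobSq (X := fun s ↦ (γ s).2.1) h.2.1
  have hC := hasDerivAt_frobSq (X := fun s ↦ (γ s).2.2) h.2.2
  have := (hA.add (hB.const_mul 2)).add hC
  refine this.congr_deriv ?_
  simp only [pairing]
  ring

/-- **`(|𝒟|²)' = 2⟨γ, γ'⟩ − R R'/3`** along a differentiable curve of block triples. [folklore] -/
theorem hasDerivAt_devNormSq (h : HamiltonODE.HasDerivAt γ γ' t) :
    HasDerivAt (fun s ↦ devNormSq (γ s))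
      (2 * pairing (γ t) γ' - scal (γ t) * scal γ' / 3) t := by
  have hR := hasDerivAt_scal h
  have := (hasDerivAt_rmNormSq h).sub (((hR.mul hR)).div_const 6)
  have e : (fun s ↦ devNormSq (γ s)) = fun s ↦ rmNormSq (γ s) - scal (γ s) * scal (γ s) / 6 :=
    funext fun s ↦ by simp only [devNormSq, sq]
  rw [e]
  exact this.congr_deriv (by ring)

/-- **First exit with strict crossing** (the scalar fencing lemma, Mathlib's
`image_le_of_deriv_right_lt_deriv_boundary` with the zero barrier): if `f(a) ≤ 0`, `f` is
differentiable on `[a, b]`, and `f' < 0` wherever `f = 0` on `[a, b)`, then `f ≤ 0` on `[a, b]`.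
[folklore] -/
theorem nonpos_of_deriv_neg_at_zero {f f' : ℝ → ℝ} {a b : ℝ}
    (hd : ∀ x ∈ Icc a b, HasDerivAt f (f' x) x) (ha : f a ≤ 0)
    (bound : ∀ x ∈ Ico a b, f x = 0 → f' x < 0) : ∀ x ∈ Icc a b, f x ≤ 0 := by
  intro x hx
  have key := image_le_of_deriv_right_lt_deriv_boundary (f := f) (f' := f') (a := a) (b := b)
    (fun y hy ↦ (hd y hy).continuousAt.continuousWithinAt)
    (fun y hy ↦ (hd y (Ico_subset_Icc_self hy)).hasDerivWithinAt)
    (B := fun _ ↦ 0) (B' := fun _ ↦ 0) ha (fun y ↦ hasDerivAt_const y 0)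
    (fun y hy hfy ↦ bound y hy hfy) hx
  exact key

end ODE

/-! ### Forward invariance under Hamilton's ODE -/

/-- **The pinching sets are forward invariant under Hamilton's ODE** `M' = M² + M^#`, GIVEN
Margerin's polynomial inequality with margin `σ > τ` on `margerinCone c` (Margerin 1998, Prop. 4:
"`β`-weak pinching is preserved"; first-exit argument with strict crossings): along a solution on
`[t₀, t₁]` starting in `Z = pinchingSet m c K τ`, the Bianchi locus is preserved
(`isInvariant_isSymm`, `isInvariant_trace_eq`), `R ≥ m` persists (`R' ≥ R²/2 > 0`), `|𝒟|² ≤ c R²`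
persists (`(|𝒟|² − cR²)' = P₂/R ≤ −σ c R R' < 0` on the boundary) and then `|𝒟|² ≤ K R^{2−τ}`
persists (`R(|𝒟|² − K R^{2−τ})' = P₂ + τ|𝒟|²R' ≤ −(σ − τ)|𝒟|²R' < 0` on the boundary).
[cite: Margerin1998, Part I, Prop. 4 and Cor. 3 (pp. 26–27)]
[cite: Hamilton1986, §5, Def. 5.1 (p. 163)] -/
theorem isInvariant_pinchingSet {m c K σ τ : ℝ} (hm : 0 < m) (hc : 0 < c) (hK : 0 < K)
    (hτ : 0 < τ) (hτσ : τ < σ)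
    (hP : ∀ p ∈ margerinCone c, margerinP2 p ≤ -(σ * (devNormSq p * scal (field p)))) :
    IsInvariant field (fun _ ↦ pinchingSet m c K τ) := by
  refine isInvariant_iff.2 fun γ t₀ t₁ h₀ h₁ hγ hin ↦ ?_
  obtain ⟨⟨hA0, hC0, htr0, -, hc0⟩, hm0, hK0⟩ := hin
  have hσ : 0 < σ := hτ.trans hτσ
  have hsymm : ∀ s ∈ Icc t₀ t₁, (γ s).1.IsSymm ∧ (γ s).2.2.IsSymm := fun s hs ↦
    isInvariant_isSymm.mem_of_mem h₀ hγ ⟨hA0, hC0⟩ hs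
  have htr : ∀ s ∈ Icc t₀ t₁, (γ s).1.trace = (γ s).2.2.trace := fun s hs ↦
    isInvariant_trace_eq.mem_of_mem h₀ hγ htr0 hs
  -- derivatives of `R` and `|𝒟|²` along the solution
  have hRd : ∀ s ∈ Icc t₀ t₁, HasDerivAt (fun r ↦ scal (γ r)) (scal (field (γ s))) s :=
    fun s hs ↦ hasDerivAt_scal (hγ s hs)
  have hDd : ∀ s ∈ Icc t₀ t₁, HasDerivAt (fun r ↦ devNormSq (γ r))
      (2 * pairing (γ s) (field (γ s)) - scal (γ s) * scal (field (γ s)) / 3) s :=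
    fun s hs ↦ hasDerivAt_devNormSq (hγ s hs)
  have hR' : ∀ s, scal (γ s) ^ 2 / 2 ≤ scal (field (γ s)) := fun s ↦
    half_scal_sq_le_scal_field _
  -- Step 1: `R ≥ m` persists
  have hRm : ∀ s ∈ Icc t₀ t₁, m ≤ scal (γ s) := by
    have key := nonpos_of_deriv_neg_at_zero (f := fun r ↦ m - scal (γ r))
      (f' := fun r ↦ -scal (field (γ r))) (a := t₀) (b := t₁)
      (fun s hs ↦ by simpa using (hRd s hs).const_sub m) (show m - scal (γ t₀) ≤ 0 by linarith)
      (fun s _ (hf : m - scal (γ s) = 0) ↦ by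
        have hRs : scal (γ s) = m := by linarith
        have h2 := hR' s
        rw [hRs] at h2
        simp only [neg_lt_zero]
        exact lt_of_lt_of_le (by positivity) h2)
    intro s hs
    have : m - scal (γ s) ≤ 0 := key s hs
    linarith
  have hRpos : ∀ s ∈ Icc t₀ t₁, 0 < scal (γ s) := fun s hs ↦ hm.trans_le (hRm s hs)
  have hR'pos : ∀ s ∈ Icc t₀ t₁, 0 < scal (field (γ s)) := fun s hs ↦
    lt_of_lt_of_le (by have := hRpos s hs; positivity) (hR' s)
  -- Step 2: `|𝒟|² ≤ c R²` persists (strict crossing by the margin `σ > 0`)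
  have hDc : ∀ s ∈ Icc t₀ t₁, devNormSq (γ s) ≤ c * scal (γ s) ^ 2 := by
    have key := nonpos_of_deriv_neg_at_zero
      (f := fun r ↦ devNormSq (γ r) - c * (scal (γ r) * scal (γ r)))
      (f' := fun r ↦ (2 * pairing (γ r) (field (γ r)) - scal (γ r) * scal (field (γ r)) / 3) -
        c * (scal (field (γ r)) * scal (γ r) + scal (γ r) * scal (field (γ r))))
      (a := t₀) (b := t₁)
      (fun s hs ↦ (hDd s hs).sub (((hRd s hs).mul (hRd s hs)).const_mul c))
      (show devNormSq (γ t₀) - c * (scal (γ t₀) * scal (γ t₀)) ≤ 0 by rw [← sq]; linarith)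
      (fun s hs (hf : devNormSq (γ s) - c * (scal (γ s) * scal (γ s)) = 0) ↦ by
        have hsI : s ∈ Icc t₀ t₁ := Ico_subset_Icc_self hs
        have hD : devNormSq (γ s) = c * (scal (γ s) * scal (γ s)) := by linarith
        have hmem : γ s ∈ margerinCone c :=
          ⟨(hsymm s hsI).1, (hsymm s hsI).2, htr s hsI, (hRpos s hsI).le, by rw [hD, sq]⟩
        have hPs := hP _ hmem
        have hRs := hRpos s hsI
        have hR's := hR'pos s hsI
        -- `R · f' = P₂ ≤ −σ |𝒟|² R' = −σ c R² R' < 0`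
        have e : scal (γ s) * ((2 * pairing (γ s) (field (γ s)) -
            scal (γ s) * scal (field (γ s)) / 3) -
            c * (scal (field (γ s)) * scal (γ s) + scal (γ s) * scal (field (γ s)))) =
            margerinP2 (γ s) := by
          unfold margerinP2
          rw [hD]
          ring
        have hneg : margerinP2 (γ s) < 0 := by
          refine lt_of_le_of_lt hPs ?_
          rw [hD, neg_lt_zero]
          positivity
        refine lt_of_not_ge fun h0 ↦ ?_
        have := mul_nonneg hRs.le h0
        rw [e] at this
        linarith)
    intro s hs
    have : devNormSq (γ s) - c * (scal (γ s) * scal (γ s)) ≤ 0 := key s hs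
    rw [sq]
    linarith
  have hcone : ∀ s ∈ Icc t₀ t₁, γ s ∈ margerinCone c := fun s hs ↦
    ⟨(hsymm s hs).1, (hsymm s hs).2, htr s hs, (hRpos s hs).le, hDc s hs⟩
  -- Step 3: `|𝒟|² ≤ K R^{2−τ}` persists (strict crossing by the margin `σ − τ > 0`)
  have hDK : ∀ s ∈ Icc t₀ t₁, devNormSq (γ s) ≤ K * scal (γ s) ^ (2 - τ) := by
    have key := nonpos_of_deriv_neg_at_zero
      (f := fun r ↦ devNormSq (γ r) - K * scal (γ r) ^ (2 - τ))
      (f' := fun r ↦ (2 * pairing (γ r) (field (γ r)) - scal (γ r) * scal (field (γ r)) / 3) -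
        K * (scal (field (γ r)) * (2 - τ) * scal (γ r) ^ (2 - τ - 1)))
      (a := t₀) (b := t₁)
      (fun s hs ↦ (hDd s hs).sub (((hRd s hs).rpow_const (Or.inl (hRpos s hs).ne')).const_mul K))
      (show devNormSq (γ t₀) - K * scal (γ t₀) ^ (2 - τ) ≤ 0 by linarith)
      (fun s hs (hf : devNormSq (γ s) - K * scal (γ s) ^ (2 - τ) = 0) ↦ by
        have hsI : s ∈ Icc t₀ t₁ := Ico_subset_Icc_self hs
        have hD : devNormSq (γ s) = K * scal (γ s) ^ (2 - τ) := by linarith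
        have hPs := hP _ (hcone s hsI)
        have hRs := hRpos s hsI
        have hR's := hR'pos s hsI
        have hDpos : 0 < devNormSq (γ s) := by
          rw [hD]
          exact mul_pos hK (Real.rpow_pos_of_pos hRs _)
        have hpow : scal (γ s) * scal (γ s) ^ (2 - τ - 1) = scal (γ s) ^ (2 - τ) := by
          rw [Real.rpow_sub_one hRs.ne']
          field_simp
        -- `R · f' = P₂ + τ |𝒟|² R' ≤ −(σ − τ) |𝒟|² R' < 0`
        have e : scal (γ s) * ((2 * pairing (γ s) (field (γ s)) -
            scal (γ s) * scal (field (γ s)) / 3) -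
            K * (scal (field (γ s)) * (2 - τ) * scal (γ s) ^ (2 - τ - 1))) =
            margerinP2 (γ s) + τ * (devNormSq (γ s) * scal (field (γ s))) := by
          have e1 : scal (γ s) * (K * (scal (field (γ s)) * (2 - τ) * scal (γ s) ^ (2 - τ - 1))) =
              (2 - τ) * (K * scal (γ s) ^ (2 - τ)) * scal (field (γ s)) := by
            rw [← hpow]
            ring
          unfold margerinP2
          rw [mul_sub, e1, ← hD]
          ring
        have hneg : margerinP2 (γ s) + τ * (devNormSq (γ s) * scal (field (γ s))) < 0 := by
          have : margerinP2 (γ s) + τ * (devNormSq (γ s) * scal (field (γ s))) ≤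
              -((σ - τ) * (devNormSq (γ s) * scal (field (γ s)))) := by linarith
          refine lt_of_le_of_lt this ?_
          rw [neg_lt_zero]
          exact mul_pos (by linarith) (mul_pos hDpos hR's)
        refine lt_of_not_ge fun h0 ↦ ?_
        have := mul_nonneg hRs.le h0
        rw [e] at this
        linarith)
    intro s hs
    have : devNormSq (γ s) - K * scal (γ s) ^ (2 - τ) ≤ 0 := key s hs
    linarith
  have h1 : t₁ ∈ Icc t₀ t₁ := right_mem_Icc.2 h₁
  exact ⟨hcone t₁ h1, hRm t₁ h1, hDK t₁ h1⟩

/-! ### The stub -/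

/-- **STUB 3 of line `margerin-cone-hamilton-rails` — THE PINCHING SETS ARE PRESERVED ALONG THE
RICCI FLOW (PDE transfer; Margerin 1998 Cor. 3 + Prop. 4 ⇒ "`β`-weak pinching is preserved",
p. 27/p. 56; Hamilton 1986 §4–§5).** Let `0 < m`, `0 < c < 1/6`, `0 < K`, `0 < τ < σ ≤ 1` and
suppose Margerin's polynomial inequality holds with margin `σ` on `margerinCone c`. Then along
every Ricci flow `(g, cov)` of Riemannian metrics on `[0, T)` on a closed smooth 4-manifold whose
initial blocks lie in `Z = pinchingSet m c K τ` (every point, every `g 0`-orthonormal frame), the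
blocks of `(g t, cov t)` lie in `Z` for all `t ∈ [0, T)`. Tensor route: `Z` is closed
(`isClosed_pinchingSet`), convex (`convex_pinchingSet`), `B ↦ −B` symmetric
(`reflectB_mem_pinchingSet`) and forward invariant under Hamilton's ODE (`isInvariant_pinchingSet`,
first exit with strict crossings from the margin `τ < σ`), so Hamilton's maximum principle for the
curvature ODE — the tree THEOREM `hamilton_maximumPrinciple_curvatureODE_holds` (Hamilton 1986,
Thm. 4.3; Chow–Lu 2004, Thm. 3) — applies to the constant family `fun _ ↦ Z`, exactly as in
`ricciFlow_mem_pcoPinchingFive_of_maximumPrinciple`. `[CompactSpace M]` is consumed by the maximum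
principle (Disproof §3a); `c < 1/6` and `σ ≤ 1` are not needed for this step.
[cite: Margerin1998, Part I, Cor. 3 and Prop. 4 (pp. 26–27), p. 56]
[cite: Hamilton1986, §4, Thm. 4.3 (p. 162); §5, 5.2 (p. 164)] [cite: ChowLu2004, Thm. 3] -/
theorem stub_pinchingPreserved :
    ∀ (m c K σ τ : ℝ), 0 < m → 0 < c → c < 1 / 6 → 0 < K → 0 < τ → τ < σ → σ ≤ 1 →
      (∀ p ∈ margerinCone c, margerinP2 p ≤ -(σ * (devNormSq p * scal (field p)))) →
      ∀ (M : Type) [TopologicalSpace M] [T2Space M] [SecondCountableTopology M] [CompactSpace M]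
        [ChartedSpace (EuclideanSpace ℝ (Fin 4)) M] [IsManifold (𝓡 4) ∞ M] (T : ℝ)
        (g : ℝ → PseudoRiemannianMetric (𝓡 4) ∞ (EuclideanSpace ℝ (Fin 4))
          (TangentSpace (𝓡 4) : M → Type _))
        (cov : ℝ → CovariantDerivative (𝓡 4) (EuclideanSpace ℝ (Fin 4))
          (TangentSpace (𝓡 4) : M → Type _)),
        IsRicciFlow g cov (Ico 0 T) → (∀ t ∈ Ico 0 T, (g t).IsRiemannian) →
        (∀ (x : M) (e : Fin 4 → TangentSpace (𝓡 4) x), (g 0).IsOrthonormalFrame x e →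
          ((g 0).blockA (cov 0) x e, (g 0).blockB (cov 0) x e, (g 0).blockC (cov 0) x e) ∈
            pinchingSet m c K τ) →
        ∀ t ∈ Ico 0 T, ∀ (x : M) (e : Fin 4 → TangentSpace (𝓡 4) x),
          (g t).IsOrthonormalFrame x e →
            ((g t).blockA (cov t) x e, (g t).blockB (cov t) x e, (g t).blockC (cov t) x e) ∈
              pinchingSet m c K τ := by
  intro m c K σ τ hm hc _hc6 hK hτ hτσ hσ1 hP M _ _ _ _ _ _ T g cov hflow hRiem h0
  have hτ2 : τ ≤ 2 := by linarith
  have hcl : IsClosed (pinchingSet m c K τ) := isClosed_pinchingSet m c K hτ2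
  exact hamilton_maximumPrinciple_curvatureODE_holds M T g cov hflow hRiem
    (fun _ ↦ pinchingSet m c K τ) (fun _ ↦ hcl)
    (fun _ ↦ convex_pinchingSet hc.le hK.le hτ.le hτ2) (isClosed_Ici.prod hcl)
    (fun _ p hp ↦ reflectB_mem_pinchingSet hp) (isInvariant_pinchingSet hm hc hK hτ hτσ hP) h0

end Summit.SmoothPoincare4.SmoothPoincare4.Theorems.MargerinRails

end
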